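import Mathlib
import HarnessLib
import Summits.Parity.GeneralizedHardyLittlewood.Theorems.ScaleTauberianCarvingUpperGlue

/-!
# Route `ScaleTauberianCarving`, glue item `LowerGlue` (stmt-Parity-31402): the finite Tauberian exchange, lower side

decomp-parity node G1.2.T «ScaleTauberianCarving» (lens-6 g6; critic CLEARED HOME/STATUS.md l.316, CRITIC-LEDGER
row 63; route born rev 0, commit 71d4b4a7eaf4).  `LowerGlue` is `LogWindowHL → ScaleRigidity → FixedLower` (the
record's stmt-Parity-26863 text verbatim behind the two new hypotheses); it is the lower half of the two-sided
exchange `twoSided_of_pieces` proved with the upper glue (`Theorems/ScaleTauberianCarvingUpperGlue.lean`).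
Hand by the cell's prover-class seat (census-1 g8).
-/

namespace Summit.Parity.GeneralizedHardyLittlewood.Theses.ScaleTauberianCarving

/-- **`LowerGlue` holds** (stmt-Parity-31402): `LogWindowHL → ScaleRigidity → FixedLower` — the lower half of
the two-sided exchange `twoSided_of_pieces`. -/
theorem lowerGlue_holds : LowerGlue := by
  intro hA hB d t hd ht Ψ hΨ ε hε
  obtain ⟨N₀, hN₀⟩ := twoSided_of_pieces hA hB d t hd ht Ψ hΨ ε hε
  refine ⟨N₀, fun N hN K hK hKN => ?_⟩
  have h := (abs_le.mp (hN₀ N hN K hK hKN)).1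
  linarith

end Summit.Parity.GeneralizedHardyLittlewood.Theses.ScaleTauberianCarving
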